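import Literature.Barriers.SmoothPoincare4.ExoticContractibleKangProofs
import Literature.Topology.FourManifolds.ConnectedSumAmphichiralUniqueness
import Literature.Topology.FourManifolds.SphereIsometryDiffeotopy
import HarnessLib

/-!
# `W ♯ (S² × S²)` is well defined (`nonempty_diffeomorph_of_isConnectedSum_sphereTwoProd` holds)

Fourth sibling proof file of `Literature/Barriers/SmoothPoincare4/ExoticContractible.lean`. It
discharges the named fact
`Literature.Barriers.SmoothPoincare4.nonempty_diffeomorph_of_isConnectedSum_sphereTwoProd` of
`ExoticContractibleKangProofs.lean` (Kosinski, *Differential Manifolds* (1993), Ch. VI §1,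
Thm. (1.1): the connected sum of connected manifolds "does not depend—up to diffeomorphism—on
the choice of `α` and of the imbeddings `hᵢ`"; Kervaire–Milnor 1963, Lemma 2.1; for the summand
`S² × S²` no orientation convention is needed because `S² × S²` admits an orientation-reversing
diffeomorphism — the folklore "`X ♯ (S² × S²)` is well defined" of Wall 1964 and of Kang's
Cor. 1.2), the leaf through which Kang's one-stabilisation pair yields Akbulut–Ruberman's Thm. B
(`akbulutRuberman2016_theoremB_of_kang`, `contractibleBarrierFour_of_kang`).

## Proof

The general mechanism is `Literature/Topology/FourManifolds/ConnectedSumAmphichiralUniqueness.lean`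
(`nonempty_diffeomorph_of_isConnectedSum_of_discs_equivalent`: for connected `M` with any model
— here a compact connected 4-manifold with boundary, NOT assumed orientable — and a summand `N`
all of whose discs are related by diffeomorphisms of `N`, any two relational connected sums are
diffeomorphic; the input is the unoriented disc theorem of `UnorientedDiscTheorem.lean`). This
file supplies the instance `N = S² × S²` (`sphereTwoProd_discs_equivalent`): by
`discs_equivalent_of_equivariant_disc` it suffices to exhibit ONE disc `c : ℝ⁴ → S² × S²` and a
diffeomorphism `ρ` of `S² × S²` with `ρ ∘ c = c ∘ r` for a linear isometry `r` of `ℝ⁴` of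
determinant `-1`. Take `r` = reflection of the first coordinate, `c (y) = (σ⁻¹ (y₀, y₁),
σ⁻¹ (y₂, y₃))` with `σ` Mathlib's stereographic chart `stereographic' 2 p` of the round `S²`, and
`ρ = (sphereCongr J) × id` where `J` is the linear isometry of `ℝ³` fixing the pole `p` which
reads as the reflection of the first coordinate in the chart `σ`
(`exists_linearIsometryEquiv_stereographic'_conj`, `SphereIsometryDiffeotopy.lean`). Everything
is proved; no named facts are introduced.

With the leaf discharged, the last section records the Kang route in its reduced form: Thm. B
and `ContractibleBarrierFour` (universe `0`) follow from Kang's Cor. 1.2 ALONE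
(`akbulutRuberman2016_theoremB_of_kang2022_corollary12`,
`contractibleBarrierFour_of_kang2022_corollary12`), from Kang's Thm. 1.1 pair plus
Freedman–Quinn (`akbulutRuberman2016_theoremB_of_kangExoticPair_freedmanQuinn`), and Kang's
barrier implies Akbulut–Ruberman's unconditionally
(`contractibleBarrierFour_of_oneStabilisationBarrier_unconditional`). Remaining leaves of the
Kang route: `kang2022_corollary12` (equivalently `kang2022_oneStabilisationExoticPair` and
`freedmanQuinn1990_homeomorph_extends_contractible`).

## References

* A. Kosinski, *Differential Manifolds* (1993), Ch. VI §1, Thm. (1.1); Ch. III, Thm. (3.6).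
  [Kosinski1993]
* M. Kervaire, J. Milnor, *Groups of homotopy spheres I*, Ann. of Math. 77 (1963), Lemma 2.1.
  [KervaireMilnorAnnals1963]
* C. T. C. Wall, *On simply-connected 4-manifolds*, J. London Math. Soc. 39 (1964), §1.
  [WallJLMS1964]
* S. Kang, *One stabilization is not enough for contractible 4-manifolds* (2022), Cor. 1.2.
  [Kang2022OneStabilization]
-/

noncomputable section

open scoped Manifold ContDiff Topology RealInnerProductSpace
open Set Module Function Filter OpenPartialHomeomorph Metric
open Literature.Topology.FourManifolds

namespace Literature.Barriers.SmoothPoincare4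

/-! ### Linear algebra on `ℝ⁴ = ℝ² × ℝ²`: splitting and the reflection of the first coordinate -/

/-- **Splitting `ℝ⁴ ≅ ℝ² × ℝ²` and a compatible pair of reflections.** There are a linear
isomorphism `Λ : ℝ⁴ ≅ ℝ² × ℝ²` (`y ↦ ((y₀, y₁), (y₂, y₃))`), a linear isometry `r` of `ℝ⁴` of
negative determinant (the reflection `y₀ ↦ -y₀`, Mathlib's `Submodule.reflection` in the
hyperplane orthogonal to `e₀`) and a linear isometry `r'` of `ℝ²` (the same reflection of the
first factor) with `Λ (r y) = (r' (Λ y).1, (Λ y).2)`. Stated as an existence lemma (this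
proofs file introduces no definitions). [folklore] -/
theorem exists_split_reflection :
    ∃ (Λ : EuclideanSpace ℝ (Fin 4) ≃L[ℝ] EuclideanSpace ℝ (Fin 2) × EuclideanSpace ℝ (Fin 2))
      (r : EuclideanSpace ℝ (Fin 4) ≃ₗᵢ[ℝ] EuclideanSpace ℝ (Fin 4))
      (r' : EuclideanSpace ℝ (Fin 2) ≃ₗᵢ[ℝ] EuclideanSpace ℝ (Fin 2)),
      LinearMap.det (r.toLinearEquiv : EuclideanSpace ℝ (Fin 4) →ₗ[ℝ] EuclideanSpace ℝ (Fin 4))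
          < 0 ∧
        ∀ y, Λ (r y) = (r' (Λ y).1, (Λ y).2) := by
  -- the splitting isomorphism
  let Λ : EuclideanSpace ℝ (Fin 4) ≃ₗ[ℝ] EuclideanSpace ℝ (Fin 2) × EuclideanSpace ℝ (Fin 2) :=
    { toFun := fun y => (!₂[y 0, y 1], !₂[y 2, y 3])
      invFun := fun z => !₂[z.1 0, z.1 1, z.2 0, z.2 1]
      map_add' := fun x y => by
        refine Prod.ext ?_ ?_
        · ext i; fin_cases i <;> simp
        · ext i; fin_cases i <;> simp
      map_smul' := fun a x => by
        refine Prod.ext ?_ ?_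
        · ext i; fin_cases i <;> simp
        · ext i; fin_cases i <;> simp
      left_inv := fun y => by
        ext i
        fin_cases i <;> simp
      right_inv := fun z => by
        obtain ⟨a, b⟩ := z
        refine Prod.ext ?_ ?_
        · ext i; fin_cases i <;> simp
        · ext i; fin_cases i <;> simp }
  -- the reflections of the first coordinate
  set e₀ : EuclideanSpace ℝ (Fin 4) := EuclideanSpace.single 0 1 with he₀_def
  set e₀' : EuclideanSpace ℝ (Fin 2) := EuclideanSpace.single 0 1 with he₀'_def
  have he₀ : e₀ ≠ 0 := fun h => by
    have := congrArg (fun v : EuclideanSpace ℝ (Fin 4) => v 0) h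
    simp [he₀_def] at this
  have hr : ∀ y : EuclideanSpace ℝ (Fin 4), (ℝ ∙ e₀)ᗮ.reflection y = !₂[-(y 0), y 1, y 2, y 3] :=
    fun y => by
      rw [reflection_orthogonal_singleton_apply]
      ext i
      fin_cases i
      · simp [he₀_def, EuclideanSpace.inner_single_left]; ring
      · simp [he₀_def, EuclideanSpace.inner_single_left]
      · simp [he₀_def, EuclideanSpace.inner_single_left]
      · simp [he₀_def, EuclideanSpace.inner_single_left]
  have hr' : ∀ a : EuclideanSpace ℝ (Fin 2), (ℝ ∙ e₀')ᗮ.reflection a = !₂[-(a 0), a 1] :=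
    fun a => by
      rw [reflection_orthogonal_singleton_apply]
      ext i
      fin_cases i
      · simp [he₀'_def, EuclideanSpace.inner_single_left]; ring
      · simp [he₀'_def, EuclideanSpace.inner_single_left]
  refine ⟨Λ.toContinuousLinearEquiv, (ℝ ∙ e₀)ᗮ.reflection, (ℝ ∙ e₀')ᗮ.reflection, ?_, fun y => ?_⟩
  · -- `det = -1`
    have h := (ℝ ∙ e₀)ᗮ.det_reflection
    have hKo : (ℝ ∙ e₀)ᗮᗮ = ℝ ∙ e₀ := Submodule.orthogonal_orthogonal _
    rw [hKo, finrank_span_singleton he₀, pow_one] at h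
    have h' : LinearMap.det ((ℝ ∙ e₀)ᗮ.reflection.toLinearEquiv :
        EuclideanSpace ℝ (Fin 4) →ₗ[ℝ] EuclideanSpace ℝ (Fin 4)) = -1 := h
    rw [h']
    norm_num
  · -- coordinates
    rw [hr y]
    show (Λ !₂[-(y 0), y 1, y 2, y 3]) = ((ℝ ∙ e₀')ᗮ.reflection (Λ y).1, (Λ y).2)
    rw [hr']
    refine Prod.ext ?_ ?_
    · ext i; fin_cases i <;> simp [Λ]
    · ext i; fin_cases i <;> simp [Λ]

/-! ### Every two discs of `S² × S²` are equivalent -/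

/-- **Any two discs `ℝ⁴ → S² × S²` are related by a diffeomorphism of `S² × S²`** (on the closed
unit ball): the hypothesis `hN` of
`Literature.Topology.FourManifolds.nonempty_diffeomorph_of_isConnectedSum_of_discs_equivalent`
for the summand `S² × S²` with Mathlib's product of the round analytic structures (model
`(𝓡 2).prod (𝓡 2)`). By `discs_equivalent_of_equivariant_disc` (unoriented disc theorem in
`S² × S²`) it suffices to give one reflection-equivariant disc: `c = (σ⁻¹ × σ⁻¹) ∘ Λ` for the
stereographic chart `σ = stereographic' 2 p`, equivariant under `ρ = sphereCongr J × id`, `J`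
the isometry of `ℝ³` fixing `p` which is the reflection of the first coordinate in the chart
`σ` (`exists_linearIsometryEquiv_stereographic'_conj`). This is the classical remark that
`S² × S²` admits an orientation-reversing diffeomorphism (a reflection of one factor), whence
`X ♯ (S² × S²)` needs no orientation convention (Wall 1964, §1; Kosinski 1993, VI §1).
[cite: Kosinski1993, Ch. VI §1, Thm (1.1)] [cite: WallJLMS1964, §1] -/
theorem sphereTwoProd_discs_equivalent
    (k k' : EuclideanSpace ℝ (Fin 4) →
      Metric.sphere (0 : EuclideanSpace ℝ (Fin 3)) 1 ×
        Metric.sphere (0 : EuclideanSpace ℝ (Fin 3)) 1)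
    (hk : Manifold.IsSmoothEmbedding 𝓘(ℝ, EuclideanSpace ℝ (Fin 4)) ((𝓡 2).prod (𝓡 2)) ∞ k)
    (hk' : Manifold.IsSmoothEmbedding 𝓘(ℝ, EuclideanSpace ℝ (Fin 4)) ((𝓡 2).prod (𝓡 2)) ∞ k') :
    ∃ g : (Metric.sphere (0 : EuclideanSpace ℝ (Fin 3)) 1 ×
        Metric.sphere (0 : EuclideanSpace ℝ (Fin 3)) 1) ≃ₘ⟮(𝓡 2).prod (𝓡 2), (𝓡 2).prod (𝓡 2)⟯
        (Metric.sphere (0 : EuclideanSpace ℝ (Fin 3)) 1 ×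
          Metric.sphere (0 : EuclideanSpace ℝ (Fin 3)) 1),
      ∀ y : EuclideanSpace ℝ (Fin 4), ‖y‖ ≤ 1 → g (k y) = k' y := by
  -- the dimension `Fact` consumed by Mathlib's `stereographic'` (inside the proof only)
  haveI : Fact (finrank ℝ (EuclideanSpace ℝ (Fin 3)) = 2 + 1) := ⟨by simp⟩
  obtain ⟨Λ, r, r', hr, hΛr⟩ := exists_split_reflection
  -- the pole and its stereographic chart
  set p : Metric.sphere (0 : EuclideanSpace ℝ (Fin 3)) 1 :=
    ⟨EuclideanSpace.single 0 1, by simp⟩ with hp_def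
  set σ := stereographic' 2 p with hσ_def
  have hσt : σ.target = univ := stereographic'_target p
  have hσs : σ.source = {p}ᶜ := stereographic'_source p
  -- the isometry of `ℝ³` fixing `p` which reads `r'` in the chart `σ`
  obtain ⟨J, hJp, hJ⟩ := exists_linearIsometryEquiv_stereographic'_conj p p r'
  have hJp' : sphereCongr J p = p := Subtype.ext (by simpa using hJp)
  have hJσ : ∀ a : EuclideanSpace ℝ (Fin 2), sphereCongr J (σ.symm a) = σ.symm (r' a) := by
    intro a
    have ha : a ∈ σ.target := by rw [hσt]; trivial
    have h1 : σ.symm a ∈ σ.source := σ.map_target ha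
    have h1' : σ.symm a ≠ p := by rw [hσs] at h1; exact h1
    have h2 : sphereCongr J (σ.symm a) ∈ σ.source := by
      rw [hσs]
      intro h
      exact h1' ((sphereCongr J).injective (h.trans hJp'.symm))
    have h3 : σ (sphereCongr J (σ.symm a)) = r' a := by
      rw [hJ (σ.symm a), σ.right_inv ha]
    rw [← h3, σ.left_inv h2]
  -- the product chart inverse is a disc `ℝ² × ℝ² → S² × S²`
  have hc₀ : Manifold.IsSmoothEmbedding 𝓘(ℝ, EuclideanSpace ℝ (Fin 2) × EuclideanSpace ℝ (Fin 2))
      ((𝓡 2).prod (𝓡 2)) ∞ (σ.prod σ).symm := by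
    have hsrc : (σ.prod σ).symm.source = univ := by
      rw [OpenPartialHomeomorph.symm_source, OpenPartialHomeomorph.prod_target, hσt, univ_prod_univ]
    have hΦ : ContMDiffOn 𝓘(ℝ, EuclideanSpace ℝ (Fin 2) × EuclideanSpace ℝ (Fin 2))
        ((𝓡 2).prod (𝓡 2)) ∞ (σ.prod σ).symm (σ.prod σ).symm.source := by
      rw [hsrc, modelWithCornersSelf_prod, ← chartedSpaceSelf_prod]
      exact ((contMDiff_stereographic'_symm p).prodMap
        (contMDiff_stereographic'_symm p)).contMDiffOn
    have hΦ' : ContMDiffOn ((𝓡 2).prod (𝓡 2))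
        𝓘(ℝ, EuclideanSpace ℝ (Fin 2) × EuclideanSpace ℝ (Fin 2)) ∞ (σ.prod σ).symm.symm
        (σ.prod σ).symm.target := by
      rw [OpenPartialHomeomorph.symm_symm, OpenPartialHomeomorph.symm_target,
        OpenPartialHomeomorph.prod_source, hσs, modelWithCornersSelf_prod, ← chartedSpaceSelf_prod]
      exact (contMDiffOn_stereographic' p).prodMap (contMDiffOn_stereographic' p)
    exact isSmoothEmbedding_of_openPartialHomeomorph _ hsrc hΦ hΦ'
      (ContinuousLinearEquiv.refl ℝ _)
  -- the equivariant disc `c = (σ⁻¹ × σ⁻¹) ∘ Λ` of `S² × S²`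
  have hc : Manifold.IsSmoothEmbedding 𝓘(ℝ, EuclideanSpace ℝ (Fin 4)) ((𝓡 2).prod (𝓡 2)) ∞
      ((σ.prod σ).symm ∘ (Λ : EuclideanSpace ℝ (Fin 4) → _)) := by
    have h := isSmoothEmbedding_disc_comp_symm hc₀ (by simp) Λ.symm
    rwa [ContinuousLinearEquiv.symm_symm] at h
  -- the symmetry `ρ = sphereCongr J × id`
  set ρ := (sphereCongr J).prodCongr
    (Diffeomorph.refl (𝓡 2) (Metric.sphere (0 : EuclideanSpace ℝ (Fin 3)) 1) ∞) with hρ_def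
  have hρ : ∀ y : EuclideanSpace ℝ (Fin 4),
      ρ (((σ.prod σ).symm ∘ (Λ : EuclideanSpace ℝ (Fin 4) → _)) y) =
        ((σ.prod σ).symm ∘ (Λ : EuclideanSpace ℝ (Fin 4) → _)) (r y) := by
    intro y
    simp only [comp_apply, hΛr, OpenPartialHomeomorph.prod_symm,
      OpenPartialHomeomorph.prod_apply, hρ_def, Diffeomorph.coe_prodCongr, Prod.map_apply,
      Diffeomorph.coe_refl, id_eq, hJσ]
  -- connectedness of `S² × S²`
  haveI : ConnectedSpace (Metric.sphere (0 : EuclideanSpace ℝ (Fin 3)) 1) := by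
    refine isConnected_iff_connectedSpace.mp (isConnected_sphere ?_ 0 zero_le_one)
    rw [← Module.finrank_eq_rank, finrank_euclideanSpace_fin]
    norm_num
  have hE : finrank ℝ (EuclideanSpace ℝ (Fin 4)) ≠ 0 := by simp
  exact discs_equivalent_of_equivariant_disc (IN := (𝓡 2).prod (𝓡 2)) hE Λ r hr hc ρ hρ k k'
    hk hk'

/-! ### The discharge -/

/-- **The named fact `nonempty_diffeomorph_of_isConnectedSum_sphereTwoProd` holds**: for a
compact connected (Hausdorff, second countable) smooth 4-manifold `W` with boundary — NOT
assumed orientable — any two connected sums `P`, `P'` of `W` with `S² × S²` in the tree's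
relational sense are diffeomorphic (Kosinski, *Differential Manifolds* (1993), Ch. VI §1,
Thm. (1.1) with Ch. III Thm. (3.6); Kervaire–Milnor 1963, Lemma 2.1; the orientation-reversing
symmetry of `S² × S²` making the orientation convention immaterial, Wall 1964 §1). Proof:
`nonempty_diffeomorph_of_isConnectedSum_of_discs_equivalent` (unoriented disc theorem in `W`,
`UnorientedDiscTheorem.lean`; uniqueness of open gluings) fed with
`sphereTwoProd_discs_equivalent`. Compactness of `W` is part of the fact's statement but not
used. [cite: Kosinski1993, Ch. VI §1, Thm (1.1)] [cite: KervaireMilnorAnnals1963, Lemma 2.1] -/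
theorem nonempty_diffeomorph_of_isConnectedSum_sphereTwoProd_holds :
    nonempty_diffeomorph_of_isConnectedSum_sphereTwoProd := by
  intro W _ _ _ _ _ _ _ P P' _ _ _ _ _ _ _ _ _ _ hP hP'
  obtain ⟨-, r, -, hr, -⟩ := exists_split_reflection
  have hE : finrank ℝ (EuclideanSpace ℝ (Fin 4)) ≠ 0 := by simp
  exact nonempty_diffeomorph_of_isConnectedSum_of_discs_equivalent hE r hr
    sphereTwoProd_discs_equivalent hP hP'

/-! ### The Kang route, reduced to its last leaf -/

/-- **Akbulut–Ruberman 2016, Thm. B (first assertion, universe `0`) from Kang's Cor. 1.2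
alone**: the tree's `akbulutRuberman2016_theoremB_of_kang` with its second hypothesis — the
well-definedness of the stabilisation `W ♯ (S² × S²)` — discharged by
`nonempty_diffeomorph_of_isConnectedSum_sphereTwoProd_holds`. "An absolutely exotic pair of
contractible 4-manifolds which remains absolutely exotic after one stabilization" (Kang, §1) is
in particular an absolutely exotic pair (Akbulut–Ruberman, Thm. B).
[cite: Kang2022OneStabilization, §1 and Cor. 1.2] [cite: AkbulutRuberman2016, Thm. B] -/
theorem akbulutRuberman2016_theoremB_of_kang2022_corollary12 (hK : kang2022_corollary12) :
    akbulutRuberman2016_theoremB.{0} :=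
  akbulutRuberman2016_theoremB_of_kang hK nonempty_diffeomorph_of_isConnectedSum_sphereTwoProd_holds

/-- **Thm. B (universe `0`) from Kang's Thm. 1.1 pair and Freedman–Quinn**: the tree's
`akbulutRuberman2016_theoremB_of_kangExoticPair` with the stabilisation hypothesis discharged;
the remaining hypotheses are Kang's un-homeomorphic one-stabilisation-exotic pair
(`kang2022_oneStabilisationExoticPair`, involutive bordered Heegaard Floer homology) and
Freedman–Quinn 11.1C / 9.3C (`freedmanQuinn1990_homeomorph_extends_contractible`).
[cite: Kang2022OneStabilization, proof of Cor. 1.2 (§5)] [cite: AkbulutRuberman2016, Thm. B] -/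
theorem akbulutRuberman2016_theoremB_of_kangExoticPair_freedmanQuinn
    (hK : kang2022_oneStabilisationExoticPair)
    (hF : freedmanQuinn1990_homeomorph_extends_contractible.{0}) :
    akbulutRuberman2016_theoremB.{0} :=
  akbulutRuberman2016_theoremB_of_kangExoticPair hK hF
    nonempty_diffeomorph_of_isConnectedSum_sphereTwoProd_holds

/-- **`ContractibleBarrierFour` (universe `0`) from Kang's Cor. 1.2 alone** (the tree's
`contractibleBarrierFour_of_kang` with the stabilisation hypothesis discharged): the barrier
"homeomorphic compact contractible smooth 4-manifolds with diffeomorphic boundaries need not be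
diffeomorphic" follows from Kang's one-stabilisation pair.
[cite: Kang2022OneStabilization, Cor. 1.2] [cite: AkbulutRuberman2016, Thm. B] -/
theorem contractibleBarrierFour_of_kang2022_corollary12 (hK : kang2022_corollary12) :
    ContractibleBarrierFour.{0} :=
  contractibleBarrierFour_of_kang hK nonempty_diffeomorph_of_isConnectedSum_sphereTwoProd_holds

/-- **Kang's barrier implies Akbulut–Ruberman's, unconditionally (universe `0`)**:
`OneStabilisationBarrier → ContractibleBarrierFour` — failure of one-stabilisation rigidity
for compact contractible 4-manifolds is a stronger failure than failure of rigidity (the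
tree's `contractibleBarrierFour_of_oneStabilisationBarrier`, whose only extra hypothesis, the
well-definedness of `W ♯ (S² × S²)`, is now proved).
[cite: Kang2022OneStabilization, §1 and Cor. 1.2] -/
theorem contractibleBarrierFour_of_oneStabilisationBarrier_unconditional
    (h : OneStabilisationBarrier) : ContractibleBarrierFour.{0} :=
  contractibleBarrierFour_of_oneStabilisationBarrier h
    nonempty_diffeomorph_of_isConnectedSum_sphereTwoProd_holds

end Literature.Barriers.SmoothPoincare4
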